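import Summits.ResolutionOfSingularities.ResolutionOfSingularities.Theorems.HilbertSamuelEliminationCampaignW42NormalConeRidgePoint
import Summits.ResolutionOfSingularities.ResolutionOfSingularities.Theorems.HilbertSamuelEliminationCampaignW42SymbolicPowerFrobenius
import Literature.AlgebraicGeometry.Resolution.Hironaka1970NearPointNormalCone
import Literature.AlgebraicGeometry.Resolution.PointBlowupHilbertSamuelStrata
import HarnessLib

/-!
# [OURS · L1 W4.2] Hironaka's THEOREM IV at near points with PERFECT `κ(x)` (and at every near point whose cone-point
# residue field is formally smooth over `κ(x)`): the ideal `J_D` of the fibre cone is generated inside Hironaka's `U(𝔭_{x'})`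
# (campaign s42, cell res-hironaka; PARTIAL DISCHARGE of the printed fact F-51′ `Hironaka1970_thmIV`;
# `--supports` stmt-ResolutionOfSingularities-17845)

HONEST FRAMING. OURS (slot W4.2, prover res-L1-s42-pv-1, gen 7). The printed fact F-51′
`Literature.AlgebraicGeometry.Resolution.Hironaka1970_thmIV` ([H4] Hironaka 1970 (Kyoto) THEOREM IV p. 156 in the form
(14.3) p. 170: at a point `x'` of a permissible blow-up NEAR to `x`, the homogeneous ideal `J_D ⊆ κ(x)[X_1, …, X_m]` of the
fibre `C_{X,D,x}` of the normal cone is generated by its elements in `U(𝔭_{x'})`, the algebra of forms of maximal multiplicity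
at the point `x'` of `ℙ(N_{D,x})`) is the last printed premise of the W4.2 crux chain in this campaign's layer (lead-1's port
v8.8, fact (5)). This file PROVES ITS CONCLUSION, with the fact's own binders, under ONE extra hypothesis on the point:

* **`normalConeIdeal_le_span_inter_multAlgebra_of_formallySmooth`** — at every near point `x'` (any level `N`, any
  generators `g` of `I_{D,x}`, any chart datum `(t, u)`; `D` permissible at `x`, `𝒪_{X,x}` universally catenary) whose
  cone-point residue field `κ(𝔭_{x'})` is FORMALLY SMOOTH over `κ(x)`;
* **`normalConeIdeal_le_span_inter_multAlgebra_of_perfectField`** — hence at EVERY near point over a point `x` with PERFECT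
  residue field `κ(x)` (closed points of varieties over perfect / finite / algebraically closed fields; characteristic `0`:
  `…_of_charZero`);
* **`hironaka1970_thmIV_of_perfectField`** — the statement of `Hironaka1970_thmIV` VERBATIM with the single added
  hypothesis `PerfectField κ(x)` (so a consumer holding `h51 : Hironaka1970_thmIV` at such a point can be fed this instead).

PROOF. The direction `ū ∈ κ(x')^m` of a near point lies in Giraud's ridge `F(J_D)(κ(x'))` (this campaign's cone theorem,
`residue_mem_ridge_normalConeIdeal_of_isNearPoint`, p525202, every characteristic, every residue field); so every additive
form `θ = Σ c_k X_k^{p^e}` of the ridge ideal `𝔉(J_D)` is killed by the chart evaluation, i.e. lies in `𝔭_{x'}`; by the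
lifting lemma (`expand_mem_symbPow_of_formallySmooth`, companion file `…CampaignW42SymbolicPowerFrobenius`) such a `θ` lies in
the symbolic power `𝔭_{x'}^{(p^e)}`, i.e. in `U(𝔭_{x'})`; hence Giraud's algebra `U_F ⊆ U(𝔭_{x'})` and Giraud's (3)
`J_D = (J_D ∩ U_F) S` (tree `eq_span_inter_ridgeAlgebra`) gives the claim. WHAT IS NOT HERE: the INSEPARABLE case (near
points `x'` with `κ(𝔭_{x'})` not formally smooth over `κ(x)`), where `U_F ⊆ U(𝔭)` is genuinely stronger than `ū ∈ F` and
only Hironaka's `ν*`-proof is known (Dietel 2015 §9.2, (9.2.7) «at this point we are stuck»).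

NOT a statement of H. Hironaka's manuscript [Hironaka2017]; the unrestricted Theorem IV stays the named fact. AI-written;
AI review is weaker than expert review. References (orientation): H. Hironaka, J. Math. Kyoto Univ. 10 (1970), TH. IV
p. 156, (13.1)–(14.3) pp. 168–170; B. Dietel, Dissertation Regensburg (2015), (9.2.2)–(9.2.7); V. Cossart, U. Jannsen,
S. Saito, LNM 2270 (2020), Thm. 3.14.
-/

noncomputable section

-- single-conjunct summit: the doubled namespace component `ResolutionOfSingularities` is mandated
set_option linter.dupNamespace false

open CategoryTheory AlgebraicGeometry TopologicalSpace IsLocalRing MvPolynomial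
open Literature.AlgebraicGeometry.Resolution Literature.AlgebraicGeometry.Resolution.HironakaScheme
open Literature.RingTheory.HilbertSamuel Literature.RingTheory.MvPolynomial

namespace Summit.ResolutionOfSingularities.ResolutionOfSingularities.Theorems

namespace CampaignW42

universe u

section Schemes

variable {X X' : Scheme.{u}} [IsLocallyNoetherian X] {π : X' ⟶ X} {D : X.IdealSheafData}

/-- **[H4] THEOREM IV at a near point whose cone-point residue field is formally smooth over `κ(x)`.** For a blow-up
`π` of `X` in `D`, permissible at `x = π x'` with `𝒪_{X,x}` universally catenary, a point `x'` NEAR to `x` at level `N`,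
generators `g` of `I_{D,x}` and a chart datum `(t, u)` at `x'` (`t` a non-zero-divisor, `I_{D,x}𝒪_{X',x'} = (t)`,
`π♯(g_i) = u_i t`): if the residue field of `κ(x)[X]` at the homogeneous prime `𝔭_{x'}` of the point is formally smooth over
`κ(x)`, then `J_D ≤ span(J_D ∩ U(𝔭_{x'}))`. [cite: Hironaka1970NumericalCharacters, THEOREM IV p. 156 and (14.3) p. 170]
[cite: Dietel2015, Thm. (9.2.2) p. 110 and Prop. (9.2.6) p. 112–113] -/
theorem normalConeIdeal_le_span_inter_multAlgebra_of_formallySmooth (hπ : IsBlowup π D) (x' : X')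
    (hperm : IdealSheafData.IsPermissibleAt D (π.base x'))
    (hUC : IsUniversallyCatenaryRing (X.presheaf.stalk (π.base x'))) {N : ℕ} (hnear : IsNearPoint π N x')
    {m : ℕ} (g : Fin m → X.presheaf.stalk (π.base x')) (hg : Ideal.span (Set.range g) = stalkIdeal D (π.base x'))
    (t : X'.presheaf.stalk x') (ht : t ∈ nonZeroDivisors (X'.presheaf.stalk x'))
    (hmap : (stalkIdeal D (π.base x')).map (π.stalkMap x').hom = Ideal.span {t})
    (u : Fin m → X'.presheaf.stalk x') (hu : ∀ i, (π.stalkMap x').hom (g i) = u i * t)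
    (hfs : haveI := isPrime_chartPrime (π.stalkMap x').hom u
      Algebra.FormallySmooth (ResidueField (X.presheaf.stalk (π.base x')))
        (ResidueField (Localization.AtPrime (chartPrime (π.stalkMap x').hom u)))) :
    normalConeIdeal g ≤ Ideal.span
      ((normalConeIdeal g : Set (MvPolynomial (Fin m) (ResidueField (X.presheaf.stalk (π.base x'))))) ∩
        (multAlgebra (ResidueField (X.presheaf.stalk (π.base x'))) (chartPrime (π.stalkMap x').hom u) :
          Set (MvPolynomial (Fin m) (ResidueField (X.presheaf.stalk (π.base x')))))) := by
  classical
  letI : Algebra (ResidueField (X.presheaf.stalk (π.base x'))) (ResidueField (X'.presheaf.stalk x')) :=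
    (ResidueField.map (π.stalkMap x').hom).toAlgebra
  haveI := isPrime_chartPrime (π.stalkMap x').hom u
  haveI := hfs
  have hridge := residue_mem_ridge_normalConeIdeal_of_isNearPoint hπ x' hperm hUC hnear g hg t ht hmap u hu
  refine le_span_inter_multAlgebra_of_forall_aeval_eq_zero (normalConeIdeal g) (isHomogeneousIdeal_normalConeIdeal g)
    (chartPrime (π.stalkMap x').hom u) (fun i => residue (X'.presheaf.stalk x') (u i))
    (fun f hf => (mem_ridge_iff_forall_ridgeIdeal.mp hridge) f hf) ?_
  intro f d hf h0
  exact (mem_chartPrime_iff_of_isHomogeneous (π.stalkMap x').hom u hf).mpr h0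

/-- **[H4] THEOREM IV AT EVERY NEAR POINT OVER A POINT WITH PERFECT RESIDUE FIELD `κ(x)`** (every characteristic; in
characteristic `p`, e.g. closed points of varieties over perfect fields): same data as
`normalConeIdeal_le_span_inter_multAlgebra_of_formallySmooth`, the formal smoothness being automatic (Mathlib:
essentially-of-finite-type extensions of a perfect field are separably generated). [cite: Hironaka1970NumericalCharacters, THEOREM IV p. 156 and (14.3) p. 170] -/
theorem normalConeIdeal_le_span_inter_multAlgebra_of_perfectField (hπ : IsBlowup π D) (x' : X')
    (hperm : IdealSheafData.IsPermissibleAt D (π.base x'))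
    (hUC : IsUniversallyCatenaryRing (X.presheaf.stalk (π.base x'))) {N : ℕ} (hnear : IsNearPoint π N x')
    {m : ℕ} (g : Fin m → X.presheaf.stalk (π.base x')) (hg : Ideal.span (Set.range g) = stalkIdeal D (π.base x'))
    (t : X'.presheaf.stalk x') (ht : t ∈ nonZeroDivisors (X'.presheaf.stalk x'))
    (hmap : (stalkIdeal D (π.base x')).map (π.stalkMap x').hom = Ideal.span {t})
    (u : Fin m → X'.presheaf.stalk x') (hu : ∀ i, (π.stalkMap x').hom (g i) = u i * t)
    (hperf : PerfectField (ResidueField (X.presheaf.stalk (π.base x')))) :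
    normalConeIdeal g ≤ Ideal.span
      ((normalConeIdeal g : Set (MvPolynomial (Fin m) (ResidueField (X.presheaf.stalk (π.base x'))))) ∩
        (multAlgebra (ResidueField (X.presheaf.stalk (π.base x'))) (chartPrime (π.stalkMap x').hom u) :
          Set (MvPolynomial (Fin m) (ResidueField (X.presheaf.stalk (π.base x')))))) :=
  haveI := isPrime_chartPrime (π.stalkMap x').hom u
  haveI := hperf
  normalConeIdeal_le_span_inter_multAlgebra_of_formallySmooth hπ x' hperm hUC hnear g hg t ht hmap u hu
    (formallySmooth_residueField_of_perfectField _)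

/-- **[H4] THEOREM IV at every near point over a point with residue field of characteristic `0`** (a characteristic-`0`
field is perfect). [cite: Hironaka1970NumericalCharacters, THEOREM IV p. 156 and (14.3) p. 170] -/
theorem normalConeIdeal_le_span_inter_multAlgebra_of_charZero (hπ : IsBlowup π D) (x' : X')
    (hperm : IdealSheafData.IsPermissibleAt D (π.base x'))
    (hUC : IsUniversallyCatenaryRing (X.presheaf.stalk (π.base x'))) {N : ℕ} (hnear : IsNearPoint π N x')
    {m : ℕ} (g : Fin m → X.presheaf.stalk (π.base x')) (hg : Ideal.span (Set.range g) = stalkIdeal D (π.base x'))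
    (t : X'.presheaf.stalk x') (ht : t ∈ nonZeroDivisors (X'.presheaf.stalk x'))
    (hmap : (stalkIdeal D (π.base x')).map (π.stalkMap x').hom = Ideal.span {t})
    (u : Fin m → X'.presheaf.stalk x') (hu : ∀ i, (π.stalkMap x').hom (g i) = u i * t)
    (h0 : CharZero (ResidueField (X.presheaf.stalk (π.base x')))) :
    normalConeIdeal g ≤ Ideal.span
      ((normalConeIdeal g : Set (MvPolynomial (Fin m) (ResidueField (X.presheaf.stalk (π.base x'))))) ∩
        (multAlgebra (ResidueField (X.presheaf.stalk (π.base x'))) (chartPrime (π.stalkMap x').hom u) :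
          Set (MvPolynomial (Fin m) (ResidueField (X.presheaf.stalk (π.base x')))))) :=
  haveI := h0
  normalConeIdeal_le_span_inter_multAlgebra_of_perfectField hπ x' hperm hUC hnear g hg t ht hmap u hu inferInstance

end Schemes

/-! ## The statement of `Hironaka1970_thmIV`, verbatim, with the one added hypothesis `PerfectField κ(x)` -/

section Verbatim

/-- **`Hironaka1970_thmIV` with perfect `κ(x)`** — the body of the named fact
`Literature.AlgebraicGeometry.Resolution.Hironaka1970_thmIV` with its binders in the same order and ONE inserted hypothesis,
`PerfectField (ResidueField (X.presheaf.stalk (π.base x')))`; PROVED (the level bound `dim X ≤ N` and the minimality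
`μ(I_{D,x}) = m` of the fact are not even used). [cite: Hironaka1970NumericalCharacters, THEOREM IV p. 156 and (14.3) p. 170] -/
theorem hironaka1970_thmIV_of_perfectField :
    ∀ (X X' : Scheme.{u}) [IsLocallyNoetherian X] (π : X' ⟶ X) (D : X.IdealSheafData) (N : ℕ)
      (x' : X') (x : X),
      Scheme.IsExcellent X → IdealSheafData.IsPermissible D → IsBlowup π D →
      topologicalKrullDim ↥X ≤ (N : WithBot ℕ∞) → π.base x' = x → x ∈ (D.support : Set X) →
      Scheme.hsFun X' N x' = Scheme.hsFun X N x →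
      PerfectField (ResidueField (X.presheaf.stalk (π.base x'))) →
      ∀ (m : ℕ) (g : Fin m → X.presheaf.stalk (π.base x'))
        (t : X'.presheaf.stalk x') (u : Fin m → X'.presheaf.stalk x'),
        Ideal.span (Set.range g) = stalkIdeal D (π.base x') →
        (stalkIdeal D (π.base x')).spanFinrank = m →
        t ∈ nonZeroDivisors (X'.presheaf.stalk x') →
        (stalkIdeal D (π.base x')).map (π.stalkMap x').hom = Ideal.span {t} →
        (∀ i, (π.stalkMap x').hom (g i) = u i * t) →
          normalConeIdeal g ≤ Ideal.span
            ((normalConeIdeal g : Set (MvPolynomial (Fin m) (ResidueField (X.presheaf.stalk (π.base x'))))) ∩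
              (HironakaScheme.multAlgebra (ResidueField (X.presheaf.stalk (π.base x')))
                (_root_.Literature.RingTheory.HilbertSamuel.chartPrime (π.stalkMap x').hom u) :
                Set (MvPolynomial (Fin m) (ResidueField (X.presheaf.stalk (π.base x')))))) := by
  intro X X' _ π D N x' x hexc hperm hπ _hdim hx hxD hnear hperf m g t u hgI _hm ht hmap hu
  subst hx
  exact normalConeIdeal_le_span_inter_multAlgebra_of_perfectField hπ x' (hperm _ hxD)
    (hexc.isUniversallyCatenaryRing_stalk _) hnear g hgI t ht hmap u hu hperf

/-- Sanity link with the named fact: `Hironaka1970_thmIV` (unrestricted) implies the perfect-field statement (trivially —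
recorded so that the audit sees the two side by side; the converse at imperfect `κ(x)` is the open inseparable case).
[cite: Hironaka1970NumericalCharacters, THEOREM IV p. 156] -/
theorem hironaka1970_thmIV_of_perfectField_of_thmIV (h51 : Hironaka1970_thmIV.{u}) :
    ∀ (X X' : Scheme.{u}) [IsLocallyNoetherian X] (π : X' ⟶ X) (D : X.IdealSheafData) (N : ℕ)
      (x' : X') (x : X),
      Scheme.IsExcellent X → IdealSheafData.IsPermissible D → IsBlowup π D →
      topologicalKrullDim ↥X ≤ (N : WithBot ℕ∞) → π.base x' = x → x ∈ (D.support : Set X) →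
      Scheme.hsFun X' N x' = Scheme.hsFun X N x →
      PerfectField (ResidueField (X.presheaf.stalk (π.base x'))) →
      ∀ (m : ℕ) (g : Fin m → X.presheaf.stalk (π.base x'))
        (t : X'.presheaf.stalk x') (u : Fin m → X'.presheaf.stalk x'),
        Ideal.span (Set.range g) = stalkIdeal D (π.base x') →
        (stalkIdeal D (π.base x')).spanFinrank = m →
        t ∈ nonZeroDivisors (X'.presheaf.stalk x') →
        (stalkIdeal D (π.base x')).map (π.stalkMap x').hom = Ideal.span {t} →
        (∀ i, (π.stalkMap x').hom (g i) = u i * t) →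
          normalConeIdeal g ≤ Ideal.span
            ((normalConeIdeal g : Set (MvPolynomial (Fin m) (ResidueField (X.presheaf.stalk (π.base x'))))) ∩
              (HironakaScheme.multAlgebra (ResidueField (X.presheaf.stalk (π.base x')))
                (_root_.Literature.RingTheory.HilbertSamuel.chartPrime (π.stalkMap x').hom u) :
                Set (MvPolynomial (Fin m) (ResidueField (X.presheaf.stalk (π.base x')))))) :=
  fun X X' _ π D N x' x hexc hperm hπ hdim hx hxD hnear _ m g t u hgI hm ht hmap hu =>
    h51 X X' π D N x' x hexc hperm hπ hdim hx hxD hnear m g t u hgI hm ht hmap hu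

end Verbatim

end CampaignW42

end Summit.ResolutionOfSingularities.ResolutionOfSingularities.Theorems

end
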